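import Summits.MatrixMultiplication.OmegaCensus.ThreeSetLineModFourSliceTail
import Summits.MatrixMultiplication.OmegaCensus.ThreeSetLineModFourSliceExc
import HarnessLib

/-!
# The bit-sliced MOD-4 FILTER, X: the parity-local obstruction and the general block checker (definitions)

ω-census `pub-omega`, family (b3), seat pub-omega-group gen 42.  Framing: lottery ticket; floor = certified bounds/negative
ranges.  VALUE: a kernel TOOL for the three-set cube cells `(4, d, e)@p²` (`ThreeSetZpCells4Core`); NOT progress on ω.
At primes `p` where `(2)` SPLITS in `ℚ(ζ_p)` (`ord_p 2` odd: `p = 31, 23, 47, …`) the norm `N(D_X)` is even for ≈ 0.2 % of the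
`X`-data — exactly the data with `𝔭𝔭̄ ∣ x` for a prime `𝔭 ∣ 2`, where the mod-4 inverse certificate cannot exist.  Those data are
dead by the LOCAL obstruction at `𝔭`: in `𝔽₂[X]/(f)` (`f = X^n + m` a factor of `Φ_p` over `𝔽₂`, root `r`), `x(r^a) = x(r^{−a}) = 0`
makes all three terms of `w̄xy + wx̄y + wxȳ = −r^{as}` vanish (`LineUnit.line_char_identity3`).  Sliced: the coordinates of
`x(r^a) = Σ_v x_v r^{av}` are XORs of parity planes selected by the LFSR table of `X^v mod f` (`lfsr`, `evalPlaneSum`), so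
the test costs a few hundred slice operations per root pair.  `blockChkG` = tail bump + sliced mod-4 filter + parity kill
(`parityKill`, parameters checked by `parityParamsOK`: `Σ_{i<p} X^i ≡ 0 mod f`) + declared exceptions (`excChkD`, norm filter).
Measured: (4,5,16)@961 killer 1 = ONE block of 324 632 data, 651 of its 672 sliced survivors parity-killed, 21 declared: 23 s.
Soundness: `ThreeSetLineModFourSliceParityAlgebra` (the ring `𝔽₂[X]/(f)`, `r^v = ofMask (lfsr v)`, the kill rule),
`ThreeSetLineModFourSliceParitySound` (`blockChkG_sound`).
-/

namespace Summit.MatrixMultiplication.OmegaCensus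

/-! # The parity-local obstruction (primes above 2 in ℚ(ζ_p)), sliced; the general block checker `blockChkG` -/

namespace LineMod

/-- One LFSR step: coordinates of `c·X mod (X^n + m(X))` over `𝔽₂` (`m` = bit mask of the lower terms). [folklore] -/
def lfsrStep (n m c : ℕ) : ℕ := if (c <<< 1).testBit n then ((c <<< 1) ^^^ 2 ^ n) ^^^ m else c <<< 1

/-- Coordinates (bit mask) of `X^v mod (X^n + m(X))` over `𝔽₂`. [folklore] -/
def lfsr (n m : ℕ) : ℕ → ℕ
  | 0 => 1
  | v + 1 => lfsrStep n m (lfsr n m v)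

/-- Sliced coordinate `b` of `x ↦ x(r^a)` (`r` the root of `X^n + m`): XOR over `v < cnt` of the parity plane of `x_v` where bit `b` of
`lfsr (a v mod p)` is set. [folklore] -/
def evalPlaneSum (p n m a b : ℕ) (X : List S2) : ℕ → ℕ
  | 0 => 0
  | v + 1 => evalPlaneSum p n m a b X v ^^^ (if (lfsr n m (a * v % p)).testBit b then (vget X v).1 else 0)

/-- Mask of the data with `x(r^a) ≠ 0` (some coordinate `b < cnt` non-zero). [folklore] -/
def evalNZ (p n m a : ℕ) (X : List S2) : ℕ → ℕ
  | 0 => 0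
  | b + 1 => evalNZ p n m a X b ||| evalPlaneSum p n m a b X p

/-- **Parity kill mask**: data with `x(r^a) = 0 = x(r^{p−a})` for some listed `a` — dead by the local obstruction at a prime above `2`
(`ThreeSetLineModFourSliceParitySound`). [folklore] -/
def parityKill (p n m ones : ℕ) (X : List S2) : List ℕ → ℕ
  | [] => 0
  | a :: as => parityKill p n m ones X as ||| ((evalNZ p n m a X n ||| evalNZ p n m (p - a) X n) ^^^ ones)

/-- XOR of the coordinate masks of `X^i`, `i < cnt`. [folklore] -/
def xorFoldLfsr (n m : ℕ) : ℕ → ℕ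
  | 0 => 0
  | i + 1 => xorFoldLfsr n m i ^^^ lfsr n m i

/-- Parameter check: `n ≥ 1`, `m < 2^n`, `Σ_{i<p} X^i ≡ 0 mod (X^n + m)` over `𝔽₂` (every coordinate count even), roots `0 < a < p`.
[folklore] -/
def parityParamsOK (p n m : ℕ) (as : List ℕ) : Bool :=
  (0 < n : Bool) && (m < 2 ^ n : Bool) && (xorFoldLfsr n m p == 0) && as.all fun a => (0 < a : Bool) && (a < p : Bool)

/-- A declared exception pinned by the sliced DIGITS (two low bits of every entry; entries `≤ 3`, length `p`, sum `d`). [folklore] -/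
def excChkD (p d : ℕ) (X : List S2) (kF : ℕ × List ℕ) : Bool :=
  (kF.2.length == p) && (kF.2.sum == d) &&
  (List.range p).all fun i => (kF.2.getD i 0 ≤ 3 : Bool) &&
    ((vget X i).1.testBit kF.1 == (kF.2.getD i 0).testBit 0) && ((vget X i).2.testBit kF.1 == (kF.2.getD i 0).testBit 1)

/-- **The general block checker**: tail bump `c₀` at coordinate `|pre|`, sliced mod-4 filter, parity kill at the root pairs `pas`
of `X^pn + pm` over `𝔽₂`, declared exceptions killed by the norm filter `LineNorm.normBlockX`. [folklore] -/
def blockChkG (p K d e : ℕ) (W pre : List ℕ) (n j c₀ : ℕ) (sched : List Bool) (pn pm : ℕ) (pas : List ℕ)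
    (exc : List (ℕ × List ℕ)) (nB nX nM g gi : ℕ) (dlog : List ℕ) (st : List Bool) (ms : List ℤ)
    (uexc : List (List ℕ × List (ℕ × ℕ × ℕ × ℕ))) : Bool :=
  let B := blockPlanes pre n j
  let ones := onesOf B.1
  let X := bumpDigits p ones pre.length c₀ (sdigits p B.2)
  (0 < p : Bool) && (3 * p < 256 : Bool) && (W.length == p) && (pre.length + n == p) && (0 < n : Bool) &&
  (pre.sum + c₀ + j == d) && (0 < W.sum * d : Bool) && (3 * (W.sum * d) * e + 1 == p * K) &&
  parityParamsOK p pn pm pas && (exc.all (excChkD p d X)) &&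
  (((survMask p ones K e W X sched) &&& (parityKill p pn pm ones X pas ^^^ ones)) ||| excMask exc == excMask exc) &&
  (exc.isEmpty || LineNorm.normBlockX p nB nX nM g gi dlog st d W (exc.map (·.2)) ms uexc)

end LineMod

end Summit.MatrixMultiplication.OmegaCensus
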